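import Mathlib
import Literature.Computability.AlgebraicComplexity.PermanentIrreducible
import Literature.Computability.AlgebraicComplexity.StandardFamiliesProofs
import Summits.ValiantsHypothesis.ValiantsHypothesis.Theorems.DivisionGapPerCofactorDegreeReductionStubAdditiveCreation

/-!
# Crux `DivisionGap.PerCofactorDegreeReduction` (stmt-ValiantsHypothesis-15046), line `Sketch` —
# stub `stub_antipodalRatioRoot`: the antipodal ratio is a root of every binary relation

**Theorem (`stub_antipodalRatioRoot`).** Let `n ≥ 1`, let `u, u' ∈ ℝ≥0[x_ij]` (`n × n` variables)
with `per_n ∤ U'` over `ℝ` (`U, U'` the real images of `u, u'` under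
`MvPolynomial.map NNReal.toRealHom`), let `γ ∈ ℝ≥0` with `per_n ∣ u + γ u'` over `ℝ`, and let
`c₀, …, c_N ∈ ℝ` with `per_n ∣ Σᵢ cᵢ Uⁱ U'^{N−i}`.  Then `Σᵢ cᵢ (−γ)ⁱ = 0`.

## Proof

`P := per_n` is prime in `ℝ[x]` (`AdditiveCreation.perPoly_prime`).  The hypothesis on `γ` reads
`P ∣ U + C γ · U'`, i.e. `Ū = C(−γ) · Ū'` in the quotient ring `ℝ[x]/(P)`.  Hence
`Ūⁱ · Ū'^{N−i} = C((−γ)ⁱ) · Ū'^N` for `i ≤ N`, and the class of the relation form is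
`C(s) · Ū'^N` with `s := Σᵢ cᵢ (−γ)ⁱ`.  The relation form lies in `(P)`, so `P ∣ C s · U'^N`.
By primality `P ∣ C s` or `P ∣ U'^N`; the latter gives `P ∣ U'` (`Prime.dvd_of_dvd_pow`), excluded.
So `P ∣ C s`; if `s ≠ 0` then `C s` is a unit and `P` would be a unit, contradicting primality.
Hence `s = 0`.

Leans on the tree only: `AdditiveCreation.perPoly_prime`; Mathlib.  No definitions.
-/

noncomputable section

-- `Summit.ValiantsHypothesis.ValiantsHypothesis.…` is the tree's mandated single-conjunct layout
-- (Problem = Summit), so the duplicated namespace component is intended.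
set_option linter.dupNamespace false

namespace Summit.ValiantsHypothesis.ValiantsHypothesis.Theorems.DivisionGap.PerCofactorDegreeReduction.AntipodalRatioRoot

open MvPolynomial Literature.Computability.AlgebraicComplexity
open scoped NNReal BigOperators

/-- The real image of `u + γ • u'` is `U + C γ * U'`. [folklore] -/
theorem map_add_smul {σ : Type*} (u u' : MvPolynomial σ ℝ≥0) (γ : ℝ≥0) :
    MvPolynomial.map NNReal.toRealHom (u + γ • u') =
      MvPolynomial.map NNReal.toRealHom u + C (γ : ℝ) * MvPolynomial.map NNReal.toRealHom u' := by
  rw [map_add, smul_eq_C_mul, map_mul, map_C, NNReal.coe_toRealHom]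

/-- A prime polynomial divides no nonzero constant: if a prime `P ∈ ℝ[x]` divides `C s` then
`s = 0`. [folklore] -/
theorem eq_zero_of_prime_dvd_C {σ : Type*} {P : MvPolynomial σ ℝ} (hP : Prime P) {s : ℝ}
    (h : P ∣ C s) : s = 0 := by
  by_contra hs
  exact hP.not_unit (isUnit_of_dvd_unit h ((isUnit_iff_ne_zero.2 hs).map C))

/-- **Substitution modulo a principal ideal.**  In a commutative ring, if `π` is a ring hom with
`π U = π (C a) * π U'` (here `π` is the quotient map by `(P)` and `C a` a constant), then the image
of a binary form `Σᵢ C(cᵢ) Uⁱ U'^{N−i}` is `π (C (Σᵢ cᵢ aⁱ)) * (π U')^N`. [folklore] -/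
theorem mk_binaryForm_eq {σ : Type*} {S : Type*} [CommRing S]
    (π : MvPolynomial σ ℝ →+* S) {U U' : MvPolynomial σ ℝ} {a : ℝ}
    (hU : π U = π (C a) * π U') (N : ℕ) (c : Fin (N + 1) → ℝ) :
    π (∑ i : Fin (N + 1), C (c i) * (U ^ (i : ℕ) * U' ^ (N - (i : ℕ)))) =
      π (C (∑ i : Fin (N + 1), c i * a ^ (i : ℕ))) * π U' ^ N := by
  rw [map_sum, map_sum (C : ℝ →+* MvPolynomial σ ℝ), map_sum, Finset.sum_mul]
  refine Finset.sum_congr rfl fun i _ => ?_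
  have hi : (i : ℕ) + (N - (i : ℕ)) = N := Nat.add_sub_cancel' (Nat.lt_succ_iff.mp i.is_lt)
  have hN : π U' ^ N = π U' ^ (i : ℕ) * π U' ^ (N - (i : ℕ)) := by
    rw [← pow_add, hi]
  rw [map_mul, map_mul, map_pow, map_pow, hU, hN, map_mul, map_mul, map_pow, map_pow]
  ring

/-- **stub_antipodalRatioRoot — THE ANTIPODAL RATIO IS A ROOT OF EVERY BINARY RELATION.**  If
`per_n ∣ u + γu'` (`n ≥ 1`, `per_n ∤ u'`) and `per_n ∣ Σᵢ cᵢ Uⁱ U'^{N−i}` for REAL coefficients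
`cᵢ` (`U, U'` the real images of `u, u'`), then `Σᵢ cᵢ (−γ)ⁱ = 0`.  Proof: `U ≡ −γ U'`, so the form
is `≡ (Σ cᵢ(−γ)ⁱ) · U'^N (mod per_n)`; `per_n` is prime and divides neither `U'^N` nor a nonzero
constant. [folklore] -/
theorem stub_antipodalRatioRoot (n N : ℕ) (hn : 1 ≤ n)
    (u u' : MvPolynomial (Fin n × Fin n) ℝ≥0)
    (hu' : ¬ perPoly (Fin n) ℝ ∣ MvPolynomial.map NNReal.toRealHom u')
    (γ : ℝ≥0) (hγ : perPoly (Fin n) ℝ ∣ MvPolynomial.map NNReal.toRealHom (u + γ • u'))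
    (c : Fin (N + 1) → ℝ)
    (hdvd : perPoly (Fin n) ℝ ∣ ∑ i : Fin (N + 1), C (c i) *
      (MvPolynomial.map NNReal.toRealHom u ^ (i : ℕ) *
        MvPolynomial.map NNReal.toRealHom u' ^ (N - (i : ℕ)))) :
    ∑ i : Fin (N + 1), c i * (-(γ : ℝ)) ^ (i : ℕ) = 0 := by
  have hprime : Prime (perPoly (Fin n) ℝ) := AdditiveCreation.perPoly_prime hn
  set P := perPoly (Fin n) ℝ with hPdef
  set U := MvPolynomial.map NNReal.toRealHom u with hUdef
  set U' := MvPolynomial.map NNReal.toRealHom u' with hU'def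
  -- the quotient map by `(P)`
  set π := Ideal.Quotient.mk (Ideal.span ({P} : Set (MvPolynomial (Fin n × Fin n) ℝ))) with hπdef
  have hπ0 : ∀ a, π a = 0 ↔ P ∣ a := fun a => by
    rw [hπdef, Ideal.Quotient.eq_zero_iff_mem, Ideal.mem_span_singleton]
  -- `Ū = C(-γ) · Ū'`
  have h1 : P ∣ U + C (γ : ℝ) * U' := by
    rw [hUdef, hU'def, ← map_add_smul]
    exact hγ
  have hU : π U = π (C (-(γ : ℝ))) * π U' := by
    have h2 : π U + π (C (γ : ℝ)) * π U' = 0 := by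
      rw [← map_mul, ← map_add]
      exact (hπ0 _).2 h1
    rw [map_neg, map_neg]
    linear_combination h2
  -- the relation form is `≡ C s · U'^N`, so `P ∣ C s · U'^N`
  have h3 : P ∣ C (∑ i : Fin (N + 1), c i * (-(γ : ℝ)) ^ (i : ℕ)) * U' ^ N := by
    rw [← hπ0, map_mul, map_pow, ← mk_binaryForm_eq π hU N c, hπ0]
    exact hdvd
  -- primality
  rcases hprime.dvd_or_dvd h3 with h4 | h4
  · exact eq_zero_of_prime_dvd_C hprime h4
  · exact absurd (hprime.dvd_of_dvd_pow h4) hu'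

end Summit.ValiantsHypothesis.ValiantsHypothesis.Theorems.DivisionGap.PerCofactorDegreeReduction.AntipodalRatioRoot

end
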